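import Summits.MatrixMultiplication.MatrixMultiplication.Theorems.PairwiseCurvedTilingsLC.Negative.ChartLine
import Summits.MatrixMultiplication.MatrixMultiplication.Theorems.PairwiseCurvedTilingsLC.Negative.ChartLift
import Summits.MatrixMultiplication.MatrixMultiplication.Theorems.PairwiseCurvedTilingsLC.Negative.ChartSmoothDatum

/-!
# The chart induction and `stub_openPiece` (line LonelyTranslates c1, Prop27Reduction)

Crux stmt-MatrixMultiplication-17883 `PairwiseCurvedTilingsLC`; registered stub `stub_openPiece`:
over a pseudo-finite field of characteristic `0`, an INFINITE definable set `A ⊆ K^m` contains a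
nonempty étale-open subset of a standard smooth locus of codimension `< m`.  This replaces, for the
line's lonely-translate argument, the Walsberg–Ye decomposition of the blocks.

`exists_goodChart` proves more, by induction on `m`: `A` carries a GOOD CHART — a coordinate
splitting into free `u ∈ K^e` (`e ≥ 1`) and bound `w ∈ K^k` coordinates, a triangular system
`D_j(u, w) = 0` whose chart ideal over `K(u)` is maximal, and a definable `X ⊆ A` on the
nonsingular part of the chart, relatively étale-open there, and Zariski-dense along `u`.
Induction step: if some fibre of `A → K^{m}` is infinite, the coordinate-line chart (`chartLine`);
otherwise the projection is infinite and definable, carries a good chart by induction, and the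
chart lifts (`chartLift`).  A good chart is in particular a standard smooth locus
(`stub_chartSmoothDatum`) of codimension `k < e + k = m` with `X` étale-open in it.
-/

set_option linter.dupNamespace false

namespace Summit.MatrixMultiplication.MatrixMultiplication.Theorems.PairwiseCurvedTilingsLC.Negative

open FirstOrder FirstOrder.Language FirstOrder.Ring
open Literature.ModelTheory.PseudofiniteFields

/-- **Good charts of infinite definable sets** (the chart induction). -/
theorem exists_goodChart (h27 : ChatzidakisVanDenDriesMacintyre1992_prop27)
    (K : Type) [Field K] [CompatibleRing K] [CharZero K] (hK : K ⊨ finiteFieldTheory) (m : ℕ) :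
    ∀ {n : ℕ} (φ : Language.ring.Formula (Fin m ⊕ Fin n)) (y : Fin n → K),
      {x : Fin m → K | φ.Realize (Sum.elim x y)}.Infinite →
      ∃ (e k : ℕ) (σ : Fin m ≃ Fin e ⊕ Fin k) (D : Fin k → MvPolynomial (Fin e ⊕ Fin k) K)
        (X : Set (Fin m → K)),
        1 ≤ e ∧
        (∀ j i : Fin k, i < j → MvPolynomial.pderiv (Sum.inr i) (D j) = 0) ∧
        (Ideal.span (Set.range fun j => MvPolynomial.aeval
          (Sum.elim (fun i => MvPolynomial.C (algebraMap (MvPolynomial (Fin e) K)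
            (FractionRing (MvPolynomial (Fin e) K)) (MvPolynomial.X i)))
            (fun j => MvPolynomial.X j)) (D j) :
              Set (MvPolynomial (Fin k) (FractionRing (MvPolynomial (Fin e) K))))).IsMaximal ∧
        X ⊆ {x | φ.Realize (Sum.elim x y)} ∧
        (∀ x ∈ X, (∀ j, MvPolynomial.eval (x ∘ σ.symm) (D j) = 0) ∧
          ∀ j, MvPolynomial.eval (x ∘ σ.symm) (MvPolynomial.pderiv (Sum.inr j) (D j)) ≠ 0) ∧
        (∀ x ∈ X, ∃ (r : ℕ) (E : EtaleDatum K m r), x ∈ E.image ∧ ∀ x' ∈ E.image,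
          (∀ j, MvPolynomial.eval (x' ∘ σ.symm) (D j) = 0) →
          (∀ j, MvPolynomial.eval (x' ∘ σ.symm) (MvPolynomial.pderiv (Sum.inr j) (D j)) ≠ 0) →
            x' ∈ X) ∧
        (∀ c : MvPolynomial (Fin e) K, c ≠ 0 →
          ∃ x ∈ X, MvPolynomial.eval (fun i => x (σ.symm (Sum.inl i))) c ≠ 0) ∧
        (∃ (n' : ℕ) (ψ : Language.ring.Formula (Fin m ⊕ Fin n')) (z : Fin n' → K),
          X = {x | ψ.Realize (Sum.elim x z)}) := by
  classical
  induction m with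
  | zero =>
    intro n φ y hinf
    exact absurd (Set.toFinite _) hinf
  | succ m ih =>
    intro n φ y hinf
    by_cases hfib : ∃ b : Fin m → K,
        {t : K | φ.Realize (Sum.elim (Fin.snoc b t : Fin (m + 1) → K) y)}.Infinite
    · obtain ⟨b, hb⟩ := hfib
      exact chartLine h27 K hK φ y b hb
    · push Not at hfib
      have hfin : ∀ b : Fin m → K,
          {t : K | φ.Realize (Sum.elim (Fin.snoc b t : Fin (m + 1) → K) y)}.Finite :=
        fun b => hfib b
      -- the projection is definable and infinite
      obtain ⟨n', ψ, z, hB⟩ := definableSet_exists_snoc (K := K)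
        (X := {x : Fin (m + 1) → K | φ.Realize (Sum.elim x y)}) ⟨n, φ, y, rfl⟩
      have hBinf : {x' : Fin m → K | ψ.Realize (Sum.elim x' z)}.Infinite := by
        rw [← hB]
        intro hBfin
        apply hinf
        have hsub : {x : Fin (m + 1) → K | φ.Realize (Sum.elim x y)} ⊆
            ⋃ x' ∈ {x' : Fin m → K | ∃ t : K, (Fin.snoc x' t : Fin (m + 1) → K) ∈
              {x : Fin (m + 1) → K | φ.Realize (Sum.elim x y)}},
              (fun t => (Fin.snoc x' t : Fin (m + 1) → K)) ''
                {t : K | φ.Realize (Sum.elim (Fin.snoc x' t : Fin (m + 1) → K) y)} := by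
          intro x hx
          simp only [Set.mem_setOf_eq] at hx
          simp only [Set.mem_iUnion, Set.mem_image, Set.mem_setOf_eq, exists_prop]
          refine ⟨Fin.init x, ⟨x (Fin.last m), ?_⟩, x (Fin.last m), ?_, Fin.snoc_init_self x⟩
          · rw [Fin.snoc_init_self]; exact hx
          · rw [Fin.snoc_init_self]; exact hx
        exact (hBfin.biUnion fun x' _ => (hfin x').image _).subset hsub
      obtain ⟨e, k, σ', D', X', he, htri', hmax', hX'B, hX'chart, hX'open, hX'dense, hX'def⟩ :=
        ih ψ z hBinf
      have hX'B' : ∀ x' ∈ X', ∃ t : K, φ.Realize (Sum.elim (Fin.snoc x' t : Fin (m + 1) → K) y) := by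
        intro x' hx'
        have := hX'B hx'
        rw [← hB] at this
        exact this
      obtain ⟨e₁, k₁, σ, D, X, h1, h2, h3, h4, h5, h6, h7, h8⟩ :=
        chartLift h27 K hK φ y hfin he σ' D' htri' hmax' X' hX'B' hX'chart hX'open hX'dense hX'def
      exact ⟨e₁, k₁, σ, D, X, h1, h2, h3, h4, h5, h6, h7, h8⟩

/-- **An infinite definable set contains a nonempty étale-open piece of a standard smooth locus of
positive dimension** (registered stub `stub_openPiece`; characteristic `0`, from CDM Prop. (2.7)). -/
theorem stub_openPiece (h27 : ChatzidakisVanDenDriesMacintyre1992_prop27)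
    (K : Type) [Field K] [CompatibleRing K] [CharZero K] (hK : K ⊨ finiteFieldTheory)
    {m n : ℕ} (φ : Language.ring.Formula (Fin m ⊕ Fin n)) (y : Fin n → K)
    (hinf : {x : Fin m → K | φ.Realize (Sum.elim x y)}.Infinite) :
    ∃ (c : ℕ) (S : SmoothDatum K m c) (X : Set (Fin m → K)), c < m ∧
      X ⊆ {x | φ.Realize (Sum.elim x y)} ∧ X.Nonempty ∧ IsEtaleOpenIn K S.locus X := by
  classical
  obtain ⟨e, k, σ, D, X, he, htri, -, hXA, hXchart, hXopen, hXdense, -⟩ :=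
    exists_goodChart h27 K hK m φ y hinf
  obtain ⟨S, hS⟩ := stub_chartSmoothDatum σ D 1 htri
  have hcard : m = e + k := by
    have := Fintype.card_congr σ
    simpa using this
  refine ⟨k, S, X, by omega, hXA, ?_, ?_, fun p hp => ?_⟩
  · obtain ⟨x, hx, -⟩ := hXdense 1 one_ne_zero
    exact ⟨x, hx⟩
  · intro x hx
    rw [hS]
    obtain ⟨h1, h2⟩ := hXchart x hx
    exact ⟨h1, by simp, h2⟩
  · obtain ⟨r, E, hpE, hE⟩ := hXopen p hp
    refine ⟨r, E, hpE, fun x hx => ?_⟩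
    rw [hS] at hx
    obtain ⟨hxE, hxD, -, hxpd⟩ := hx
    exact hE x hxE hxD hxpd

end Summit.MatrixMultiplication.MatrixMultiplication.Theorems.PairwiseCurvedTilingsLC.Negative
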